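import Literature.NumberTheory.EllipticCurves.Sprung2017.SharpFlatNonvanishingProofs
import Summits.BirchSwinnertonDyer.Rank1Residual.Supersingular.SprungConstantTerm
import Literature.NumberTheory.EllipticCurves.Rank1Residual.Predicates
import Literature.NumberTheory.EllipticCurves.CuspFormLFunctionAnalyticRankProofs
import Literature.NumberTheory.EllipticCurves.AnalyticRankOrderProofs
import Literature.NumberTheory.EllipticCurves.LeadingTermPPartProofs
import HarnessLib

/-!
# Sprung 2012, Prop. 6.14 for the REAL pair `(L♯, L♭)`: not both zero (Rohrlich), and BOTH non-zero
# in analytic rank `0` — so Sprung's Conj. 6.15 / Conj. 4.12 HOLDS on `{good supersingular odd p} ∩ {r_an = 0}`,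
# in particular on X8 ∩ {r_an = 0} (cell `b2b-bsdres`, supersingular family, prover B = unit
# `b2b-bsdres-additive-p3`, gen 16)

HONEST FRAMING (run/shared/lean/b2b/bsd-rank1-residual/, verbatim in every file): the goal of the
cell is to DELETE the COMBINATION-SHAPED residual classes of the Birch–Swinnerton-Dyer formula for
ALL analytic-rank `≤ 1` elliptic curves over `ℚ` — "full BSD formula for every rank `≤ 1` curve in
class `C`" assembled STRICTLY from published theorems — so that the rank-`≤ 1` remainder becomes
exactly the CONSTRUCTION-SHAPED classes, which are TYPED (missing-input `Prop`s), NOT attempted.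
This is not "finishing BSD". THEOREMS ONLY (no definition, no named fact, nothing about any
particular curve asserted); no label of the cell moves (X6/X7/X8 stay CONSTRUCTION-SHAPED); nothing
is booked.

## What this file does

The Literature companion `Sprung2017/SharpFlatNonvanishingProofs.lean` (same gen) PROVES the first
sentence of Sprung, J. Number Theory 132 (2012) **Prop. 6.14** (p. 1498) for the tree's Mazur–Tate
pairs: for ANY `(L♯, L♭)` with `IsSprungPair f p a L♯ L♭`, `f` the newform of an elliptic curve with
good reduction at `p`, **`L♯ ≠ 0 ∨ L♭ ≠ 0`** (`IsSprungPair.ne_zero_or_ne_zero`; Rohrlich 1984 is a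
tree theorem). This file adds the second sentence — "If `L(E, 1) ≠ 0`, then they are both nonzero"
— from the constant-term table (P•) PROVED in `Supersingular/SprungConstantTerm.lean`
(`constantCoeff_chromaticL_of_isSprungPair`: `L^•(0) = c_• · [0]⁺_f`, `c_♯ = −a_p² + 2a_p + p − 1`,
`c_♭ = 2 − a_p`) together with two arithmetic remarks: `c_♯ ≠ 0` for EVERY integer `a_p` at EVERY
prime `p` (`c_♯ = 0 ⟺ (a_p − 1)² = p`, and a prime is not a square), and `c_♭ ≠ 0` as soon as
`a_p ≠ 2`, automatic at an odd supersingular prime (`p ∣ a_p`). Consequences, all PROVED here: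

* `chromaticL_ne_zero_of_ratPlusSymbol_zero_ne_zero`: `c_• ≠ 0 ∧ [0]⁺_f ≠ 0 ⟹ L^• ≠ 0`;
  `sharp_ne_zero_and_flat_ne_zero_of_ratPlusSymbol_zero_ne_zero`: at odd `p ∣ a_p`, `[0]⁺_f ≠ 0 ⟹
  L♯ ≠ 0 ∧ L♭ ≠ 0`.
* For the newform of `E` (`IsNewformOf W f`; `[0]⁺_f·Ω⁺_f = L(E,1)`, `IsNewformOf.entireLFunction_one_eq`):
  `sharp_ne_zero_and_flat_ne_zero_of_entireLFunction_one_ne_zero` (`L(E,1) ≠ 0`),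
  `…_of_analyticRank_eq_zero` (`r_an(E) = 0`, via `analyticRank_eq_zero_iff_holds` on the entire
  continuation `IsNewformOf.hasEntireLFunction`) — **Prop. 6.14, second sentence**; and the whole
  proposition in one line, `sprung_prop614`:
  `(L♯ ≠ 0 ∨ L♭ ≠ 0) ∧ (r_an(E) = 0 → L♯ ≠ 0 ∧ L♭ ≠ 0)`.
* So Sprung's **Conjecture 6.15** (JNT 2012) = **Conjecture 4.12** (ANT 2017) — "`L♯` and `L♭` are
  both nonzero" — HOLDS on the locus `{p odd good supersingular} ∩ {r_an(E) = 0}`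
  (`chromaticL_ne_zero_of_goodSS_of_analyticRank_eq_zero`), in particular on **X8 ∩ {r_an = 0}**
  (`ClassX8.chromaticL_ne_zero_of_analyticRank_eq_zero`) and X7/X6 ∩ {r_an = 0} (where `a_p = 0`
  and it was already Pollack's Cor. 5.11); on all of X8 (any rank) SOME colour is non-zero
  (`ClassX8.exists_chromaticL_ne_zero`), likewise X7/X6 (`ClassX7/ClassX6.exists_chromaticL_ne_zero`).
  In positive analytic rank the conjecture stays OPEN (per pair it is a one-value certificate,
  `Supersingular/MazurTateValuationPropagation.lean`); nothing here claims it.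

What this is good for (per pair, displayed binders unchanged): Sprung's Main Conjecture 1.3 / 7.21
and Thm. 1.2 / 1.4 are stated for "`∗ ∈ {♯, ♭}` so that `L^∗ ≠ 0`"; that such a colour EXISTS is now
a tree theorem for every X8 (X7, X6) pair, and in analytic rank `0` EITHER colour qualifies.

References: [Sprung2012] Prop. 6.14, Conj. 6.15 (p. 1498), Main Conj. 1.3; [Sprung2017] Cor. 4.11
(table), Conj. 4.12; [RohrlichInventiones1984] Theorem (p. 409); [Pollack2003] Cor. 5.11;
[MazurTateTeitelbaum1986Invent] §I.8. Design: theorems only; default heartbeats; axioms standard.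
-/

set_option autoImplicit false

noncomputable section

open scoped Classical MatrixGroups ModularForm

open CongruenceSubgroup Polynomial WeierstrassCurve Literature.NumberTheory.EllipticCurves
  Literature.NumberTheory.EllipticCurves.ModularForms
  Literature.NumberTheory.EllipticCurves.Rank1Residual
  Literature.NumberTheory.EllipticCurves.Sprung2017

namespace Summit.BirchSwinnertonDyer.Rank1Residual.Supersingular

/-! ### The chromatic constants do not vanish -/

section Constants

variable (p : ℕ) [hp : Fact p.Prime]

/-- **`c_♯ = −a² + 2a + p − 1 ≠ 0` for every integer `a` and every prime `p`**: `c_♯ = 0` says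
`(a − 1)² = p`, and a prime is not a perfect square (`m² = p` with `m = |a − 1|` gives `m ∣ p`, so
`m = 1`, `p = 1`, or `m = p`, `p² = p`). [cite: Sprung2017, Cor. 4.11 (table of special values)] -/
theorem chromaticConst_sharp_ne_zero (a : ℤ) : chromaticConst p a .sharp ≠ 0 := by
  rw [chromaticConst_sharp]
  intro h
  obtain ⟨m, hm⟩ : ∃ m : ℕ, m ^ 2 = p := by
    refine ⟨(a - 1).natAbs, ?_⟩
    have h1 : (((a - 1).natAbs : ℕ) : ℤ) ^ 2 = p := by
      rw [Int.natAbs_sq]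
      linear_combination -h
    exact_mod_cast h1
  have hmp : m ∣ p := Dvd.intro m (by rw [← hm, sq])
  rcases (Nat.dvd_prime hp.out).mp hmp with h1 | h1
  · rw [h1, one_pow] at hm
    exact hp.out.ne_one hm.symm
  · rw [h1] at hm
    have h2 : p * p = p * 1 := by rw [mul_one, ← sq, hm]
    exact hp.out.ne_one (Nat.eq_of_mul_eq_mul_left hp.out.pos h2)

omit hp in
/-- **`c_♭ = 2 − a ≠ 0` whenever `a ≠ 2`.** [cite: Sprung2017, Cor. 4.11 (table of special values)] -/
theorem chromaticConst_flat_ne_zero_of_ne_two {a : ℤ} (ha : a ≠ 2) :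
    chromaticConst p a .flat ≠ 0 := by
  rw [chromaticConst_flat]
  omega

/-- At an ODD prime `p` with `p ∣ a` (good SUPERSINGULAR reduction, `a = a_p`), `a ≠ 2`.
[cite: Sprung2017, Cor. 4.11 (table of special values)] -/
theorem ne_two_of_dvd_of_ne_two (hp2 : p ≠ 2) {a : ℤ} (h : (p : ℤ) ∣ a) : a ≠ 2 := by
  rintro rfl
  have h2 : (p : ℤ) ∣ (2 : ℕ) := by exact_mod_cast h
  have := (Nat.prime_dvd_prime_iff_eq hp.out Nat.prime_two).mp (by exact_mod_cast h2)
  exact hp2 this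

/-- **Both chromatic constants are non-zero at an odd supersingular prime**: `p ≠ 2`, `p ∣ a` ⟹
`c_•(p, a) ≠ 0` for `• ∈ {♯, ♭}`. [cite: Sprung2017, Cor. 4.11 (table of special values)] -/
theorem chromaticConst_ne_zero_of_dvd (hp2 : p ≠ 2) {a : ℤ} (h : (p : ℤ) ∣ a) (c : Chroma) :
    chromaticConst p a c ≠ 0 := by
  cases c with
  | sharp => exact chromaticConst_sharp_ne_zero p a
  | flat => exact chromaticConst_flat_ne_zero_of_ne_two p (ne_two_of_dvd_of_ne_two p hp2 h)

end Constants

/-! ### `[0]⁺_f ≠ 0` ⟹ `L^• ≠ 0` (any Sprung pair of a rational newform) -/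

section RankZeroPair

variable {N : ℕ} [NeZero N] {f : CuspForm (Gamma0 N) 2} {p : ℕ} [hp : Fact p.Prime]

/-- **`c_• ≠ 0` and `[0]⁺_f ≠ 0` ⟹ `L^• ≠ 0`**: the constant term of `L^•` is `c_•·[0]⁺_f`
(`constantCoeff_chromaticL_of_isSprungPair`, (P•) PROVED), a non-zero element of `ℚ_p`.
(`p` odd, `f` a rational newform of level prime to `p` with `a_p(f) = a`, any pair with
`IsSprungPair f p a L♯ L♭`.) [cite: Sprung2012, Prop. 6.14 (p. 1498)]
[cite: Sprung2017, Cor. 4.11 (table of special values)] -/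
theorem chromaticL_ne_zero_of_ratPlusSymbol_zero_ne_zero (hp2 : p ≠ 2) (hf0 : IsNewform0 f)
    (hQ : coeffField f = ⊥) (hpN : ¬ p ∣ N) {a : ℤ} (hap : cuspCoeff f p = a)
    {Lsharp Lflat : IwasawaAlgebra p} (hSP : IsSprungPair f p a Lsharp Lflat) (c : Chroma)
    (hc : chromaticConst p a c ≠ 0) (hr : ratPlusSymbol f 0 ≠ 0) :
    chromaticL c Lsharp Lflat ≠ 0 := by
  intro h0
  have h := constantCoeff_chromaticL_of_isSprungPair hp2 hf0 hQ hpN hap hSP c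
  rw [h0, map_zero, PadicInt.coe_zero, eq_comm, mul_eq_zero] at h
  rcases h with h | h
  · exact hc (by exact_mod_cast h)
  · exact hr (by exact_mod_cast h)

/-- **Prop. 6.14, second sentence, for a pair of a rational newform**: at an odd prime `p ∤ N` with
`p ∣ a_p(f)`, `[0]⁺_f ≠ 0` ⟹ `L♯ ≠ 0 ∧ L♭ ≠ 0`. [cite: Sprung2012, Prop. 6.14 (p. 1498)] -/
theorem sharp_ne_zero_and_flat_ne_zero_of_ratPlusSymbol_zero_ne_zero (hp2 : p ≠ 2)
    (hf0 : IsNewform0 f) (hQ : coeffField f = ⊥) (hpN : ¬ p ∣ N) {a : ℤ} (hap : cuspCoeff f p = a)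
    (hss : (p : ℤ) ∣ a) {Lsharp Lflat : IwasawaAlgebra p} (hSP : IsSprungPair f p a Lsharp Lflat)
    (hr : ratPlusSymbol f 0 ≠ 0) : Lsharp ≠ 0 ∧ Lflat ≠ 0 :=
  ⟨by simpa only [chromaticL_sharp] using
      chromaticL_ne_zero_of_ratPlusSymbol_zero_ne_zero hp2 hf0 hQ hpN hap hSP .sharp
        (chromaticConst_ne_zero_of_dvd p hp2 hss .sharp) hr,
   by simpa only [chromaticL_flat] using
      chromaticL_ne_zero_of_ratPlusSymbol_zero_ne_zero hp2 hf0 hQ hpN hap hSP .flat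
        (chromaticConst_ne_zero_of_dvd p hp2 hss .flat) hr⟩

end RankZeroPair

/-! ### The newform of an elliptic curve: Prop. 6.14 in full -/

section Curve

variable {W : WeierstrassCurve ℚ} [W.IsElliptic] [W.IsGloballyMinimal] {N : ℕ} [NeZero N]
  {f : CuspForm (Gamma0 N) 2} {p : ℕ} [hp : Fact p.Prime]

omit [W.IsGloballyMinimal] hp in
/-- `L(E, 1) ≠ 0 ⟹ [0]⁺_f ≠ 0` for the newform `f` of `E`: `L(E,1) = [0]⁺_f · Ω⁺_f`
(`IsNewformOf.entireLFunction_one_eq`; Mazur–Tate–Teitelbaum §I.8). [cite: MazurTateTeitelbaum1986Invent, §I.8 (8.6)] -/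
theorem ratPlusSymbol_zero_ne_zero_of_entireLFunction_one_ne_zero (hf : IsNewformOf W f)
    (hL : W.entireLFunction 1 ≠ 0) : ratPlusSymbol f 0 ≠ 0 := by
  intro h0
  apply hL
  rw [hf.entireLFunction_one_eq, h0]
  push_cast
  ring

omit [W.IsGloballyMinimal] hp in
/-- `r_an(E) = 0 ⟹ [0]⁺_f ≠ 0` for the newform `f` of `E` (the order of vanishing of the entire
continuation `IsNewformOf.hasEntireLFunction` is `0` iff `L(E,1) ≠ 0`, `analyticRank_eq_zero_iff_holds`).
[cite: MazurTateTeitelbaum1986Invent, §I.8 (8.6)] [cite: BirchSwinnertonDyer1965] -/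
theorem ratPlusSymbol_zero_ne_zero_of_analyticRank_eq_zero (hf : IsNewformOf W f)
    (h0 : W.analyticRank = 0) : ratPlusSymbol f 0 ≠ 0 :=
  ratPlusSymbol_zero_ne_zero_of_entireLFunction_one_ne_zero hf
    ((W.analyticRank_eq_zero_iff_holds hf.hasEntireLFunction).1 h0)

/-- **Sprung 2012, Prop. 6.14, second sentence (`η = 1`)**: for `f` the newform of `E = W`, `p` an
ODD prime of good SUPERSINGULAR reduction (`p ∣ a_p(E)`), and ANY Sprung pair `(L♯, L♭)` for
`a_p(E)`: **`L(E, 1) ≠ 0 ⟹ L♯ ≠ 0 ∧ L♭ ≠ 0`** (constant terms `c_•·L(E,1)/Ω⁺_f` with `c_♯, c_♭ ≠ 0`).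
[cite: Sprung2012, Prop. 6.14 (p. 1498)] [cite: Sprung2017, Cor. 4.11 (table of special values)] -/
theorem sharp_ne_zero_and_flat_ne_zero_of_entireLFunction_one_ne_zero (hp2 : p ≠ 2)
    (hf : IsNewformOf W f) (hgood : W.HasGoodReductionAtPrime p)
    (hss : (p : ℤ) ∣ W.frobeniusTrace p) {Lsharp Lflat : IwasawaAlgebra p}
    (hSP : IsSprungPair f p (W.frobeniusTrace p) Lsharp Lflat) (hL : W.entireLFunction 1 ≠ 0) :
    Lsharp ≠ 0 ∧ Lflat ≠ 0 :=
  sharp_ne_zero_and_flat_ne_zero_of_ratPlusSymbol_zero_ne_zero hp2 hf.1 hf.coeffField_eq_bot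
    (not_dvd_level_of_isNewformOf hf hgood) (cuspCoeff_eq_frobeniusTrace_of_isNewformOf_holds hf hgood)
    hss hSP (ratPlusSymbol_zero_ne_zero_of_entireLFunction_one_ne_zero hf hL)

/-- **Prop. 6.14, second sentence, analytic-rank form**: `r_an(E) = 0 ⟹ L♯ ≠ 0 ∧ L♭ ≠ 0` (odd good
supersingular `p`, any Sprung pair for `a_p(E)`). [cite: Sprung2012, Prop. 6.14 (p. 1498)] -/
theorem sharp_ne_zero_and_flat_ne_zero_of_analyticRank_eq_zero (hp2 : p ≠ 2)
    (hf : IsNewformOf W f) (hgood : W.HasGoodReductionAtPrime p)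
    (hss : (p : ℤ) ∣ W.frobeniusTrace p) {Lsharp Lflat : IwasawaAlgebra p}
    (hSP : IsSprungPair f p (W.frobeniusTrace p) Lsharp Lflat) (h0 : W.analyticRank = 0) :
    Lsharp ≠ 0 ∧ Lflat ≠ 0 :=
  sharp_ne_zero_and_flat_ne_zero_of_entireLFunction_one_ne_zero hp2 hf hgood hss hSP
    ((W.analyticRank_eq_zero_iff_holds hf.hasEntireLFunction).1 h0)

/-- Chromatic form: **in analytic rank `0`, EVERY colour `L^•` of every Sprung pair is non-zero** at
an odd good supersingular prime — Sprung's Conjecture 6.15 (JNT 2012) / Conjecture 4.12 (ANT 2017)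
HOLDS on the locus `GoodSS ∩ {r_an = 0}`. [cite: Sprung2012, Prop. 6.14 and Conj. 6.15 (p. 1498)]
[cite: Sprung2017, Conj. 4.12] -/
theorem chromaticL_ne_zero_of_goodSS_of_analyticRank_eq_zero (hp2 : p ≠ 2)
    (hf : IsNewformOf W f) (hG : GoodSS W p) {Lsharp Lflat : IwasawaAlgebra p}
    (hSP : IsSprungPair f p (W.frobeniusTrace p) Lsharp Lflat) (h0 : W.analyticRank = 0)
    (c : Chroma) : chromaticL c Lsharp Lflat ≠ 0 := by
  obtain ⟨h1, h2⟩ := sharp_ne_zero_and_flat_ne_zero_of_analyticRank_eq_zero hp2 hf hG.1 hG.2 hSP h0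
  cases c with
  | sharp => rwa [chromaticL_sharp]
  | flat => rwa [chromaticL_flat]

/-- **Sprung 2012, Prop. 6.14 (`η = 1`) in one line**, for `f` the newform of `E`, `p` an odd good
supersingular prime and any Sprung pair for `a_p(E)`:
`(L♯ ≠ 0 ∨ L♭ ≠ 0) ∧ (r_an(E) = 0 → L♯ ≠ 0 ∧ L♭ ≠ 0)` — first conjunct by Rohrlich
(`IsSprungPair.ne_zero_or_ne_zero`, no parity / supersingularity needed), second by the constant
terms. [cite: Sprung2012, Prop. 6.14 (p. 1498)] [cite: RohrlichInventiones1984, Theorem (p. 409)] -/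
theorem sprung_prop614 (hp2 : p ≠ 2) (hf : IsNewformOf W f) (hG : GoodSS W p)
    {Lsharp Lflat : IwasawaAlgebra p} (hSP : IsSprungPair f p (W.frobeniusTrace p) Lsharp Lflat) :
    (Lsharp ≠ 0 ∨ Lflat ≠ 0) ∧ (W.analyticRank = 0 → Lsharp ≠ 0 ∧ Lflat ≠ 0) :=
  ⟨hSP.ne_zero_or_ne_zero hf hG.1,
    fun h0 ↦ sharp_ne_zero_and_flat_ne_zero_of_analyticRank_eq_zero hp2 hf hG.1 hG.2 hSP h0⟩

/-- **If one colour vanishes, `E` has positive analytic rank** (contrapositive of the second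
sentence): at an odd good supersingular prime, `L^• = 0` for some `•` ⟹ `r_an(E) ≠ 0`, i.e.
`L(E, 1) = 0`. [cite: Sprung2012, Prop. 6.14 (p. 1498)] -/
theorem analyticRank_ne_zero_of_chromaticL_eq_zero (hp2 : p ≠ 2) (hf : IsNewformOf W f)
    (hG : GoodSS W p) {Lsharp Lflat : IwasawaAlgebra p}
    (hSP : IsSprungPair f p (W.frobeniusTrace p) Lsharp Lflat) {c : Chroma}
    (h : chromaticL c Lsharp Lflat = 0) : W.analyticRank ≠ 0 :=
  fun h0 ↦ chromaticL_ne_zero_of_goodSS_of_analyticRank_eq_zero hp2 hf hG hSP h0 c h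

end Curve

/-! ### The classes X8, X7, X6 -/

section Classes

variable (W : WeierstrassCurve ℚ) [W.IsElliptic] [W.IsGloballyMinimal] (p : ℕ) [hp : Fact p.Prime]
  {N : ℕ} [NeZero N] {f : CuspForm (Gamma0 N) 2}

/-- **X8 (any analytic rank): SOME colour of Sprung's pair is non-zero** — for `f` the newform of
`E ∈ X8` (`p = 3` good supersingular, `a_3 = ±3`) and any `(L♯, L♭)` with
`IsSprungPair f p (a_p E) L♯ L♭`: `∃ • ∈ {♯, ♭}, L^• ≠ 0`. So the colour "`∗` with `L^∗ ≠ 0`" of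
Sprung's Thm. 1.2 / Main Conj. 1.3 / Thm. 1.4 EXISTS at every X8 pair (Rohrlich).
[cite: Sprung2012, Prop. 6.14 (p. 1498) and Main Conj. 1.3] -/
theorem ClassX8.exists_chromaticL_ne_zero (hX : ClassX8 W p) (hf : IsNewformOf W f)
    {Lsharp Lflat : IwasawaAlgebra p} (hSP : IsSprungPair f p (W.frobeniusTrace p) Lsharp Lflat) :
    ∃ c : Chroma, chromaticL c Lsharp Lflat ≠ 0 := by
  obtain ⟨hp3, hG, -⟩ := hX
  subst hp3
  exact hSP.exists_chromaticL_ne_zero hf hG.1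

/-- X8: `L♯ ≠ 0 ∨ L♭ ≠ 0`. [cite: Sprung2012, Prop. 6.14 (p. 1498)] -/
theorem ClassX8.sharp_ne_zero_or_flat_ne_zero (hX : ClassX8 W p) (hf : IsNewformOf W f)
    {Lsharp Lflat : IwasawaAlgebra p} (hSP : IsSprungPair f p (W.frobeniusTrace p) Lsharp Lflat) :
    Lsharp ≠ 0 ∨ Lflat ≠ 0 := by
  obtain ⟨hp3, hG, -⟩ := hX
  subst hp3
  exact hSP.ne_zero_or_ne_zero hf hG.1

/-- **X8 ∩ {r_an = 0}: BOTH colours are non-zero** — Sprung's Conj. 6.15 / 4.12 holds on the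
rank-zero part of X8 (any Sprung pair for `a_3(E) = ±3`; `c_♯ ∈ {−1, −13}`, `c_♭ ∈ {−1, 5}`).
[cite: Sprung2012, Prop. 6.14 and Conj. 6.15 (p. 1498)] [cite: Sprung2017, Conj. 4.12] -/
theorem ClassX8.chromaticL_ne_zero_of_analyticRank_eq_zero (hX : ClassX8 W p)
    (hf : IsNewformOf W f) {Lsharp Lflat : IwasawaAlgebra p}
    (hSP : IsSprungPair f p (W.frobeniusTrace p) Lsharp Lflat) (h0 : W.analyticRank = 0)
    (c : Chroma) : chromaticL c Lsharp Lflat ≠ 0 := by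
  obtain ⟨hp3, hG, -⟩ := hX
  subst hp3
  exact chromaticL_ne_zero_of_goodSS_of_analyticRank_eq_zero (by decide) hf hG hSP h0 c

/-- X8 ∩ {r_an = 0}: `L♯ ≠ 0 ∧ L♭ ≠ 0`. [cite: Sprung2012, Prop. 6.14 (p. 1498)] -/
theorem ClassX8.sharp_ne_zero_and_flat_ne_zero_of_analyticRank_eq_zero (hX : ClassX8 W p)
    (hf : IsNewformOf W f) {Lsharp Lflat : IwasawaAlgebra p}
    (hSP : IsSprungPair f p (W.frobeniusTrace p) Lsharp Lflat) (h0 : W.analyticRank = 0) :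
    Lsharp ≠ 0 ∧ Lflat ≠ 0 := by
  obtain ⟨hp3, hG, -⟩ := hX
  subst hp3
  exact sharp_ne_zero_and_flat_ne_zero_of_analyticRank_eq_zero (by decide) hf hG.1 hG.2 hSP h0

/-- **X7 (any analytic rank, any good supersingular `p`): SOME colour of a Sprung pair is
non-zero.** (On X7 with `p` odd, `a_p = 0` and the pair is Pollack's, where BOTH are non-zero by
Pollack's Cor. 5.11 — `exists_isSprungPair_of_frobeniusTrace_eq_zero`; this form needs neither.)
[cite: Sprung2012, Prop. 6.14 (p. 1498)] -/
theorem ClassX7.exists_chromaticL_ne_zero (hX : ClassX7 W p) (hf : IsNewformOf W f)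
    {a : ℤ} {Lsharp Lflat : IwasawaAlgebra p} (hSP : IsSprungPair f p a Lsharp Lflat) :
    ∃ c : Chroma, chromaticL c Lsharp Lflat ≠ 0 :=
  hSP.exists_chromaticL_ne_zero hf hX.1.1

/-- **X6 (any analytic rank): SOME colour of a Sprung pair is non-zero.**
[cite: Sprung2012, Prop. 6.14 (p. 1498)] -/
theorem ClassX6.exists_chromaticL_ne_zero (hX : ClassX6 W p) (hf : IsNewformOf W f)
    {a : ℤ} {Lsharp Lflat : IwasawaAlgebra p} (hSP : IsSprungPair f p a Lsharp Lflat) :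
    ∃ c : Chroma, chromaticL c Lsharp Lflat ≠ 0 :=
  hSP.exists_chromaticL_ne_zero hf hX.1.1

/-- **X7 ∩ {r_an = 0}, `p` odd: BOTH colours of any Sprung pair for `a_p(E)` are non-zero.**
[cite: Sprung2012, Prop. 6.14 and Conj. 6.15 (p. 1498)] -/
theorem ClassX7.chromaticL_ne_zero_of_analyticRank_eq_zero (hp2 : p ≠ 2) (hX : ClassX7 W p)
    (hf : IsNewformOf W f) {Lsharp Lflat : IwasawaAlgebra p}
    (hSP : IsSprungPair f p (W.frobeniusTrace p) Lsharp Lflat) (h0 : W.analyticRank = 0)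
    (c : Chroma) : chromaticL c Lsharp Lflat ≠ 0 :=
  chromaticL_ne_zero_of_goodSS_of_analyticRank_eq_zero hp2 hf hX.1 hSP h0 c

/-- **X6 ∩ {r_an = 0}, `p` odd: BOTH colours of any Sprung pair for `a_p(E)` are non-zero.**
[cite: Sprung2012, Prop. 6.14 and Conj. 6.15 (p. 1498)] -/
theorem ClassX6.chromaticL_ne_zero_of_analyticRank_eq_zero (hp2 : p ≠ 2) (hX : ClassX6 W p)
    (hf : IsNewformOf W f) {Lsharp Lflat : IwasawaAlgebra p}
    (hSP : IsSprungPair f p (W.frobeniusTrace p) Lsharp Lflat) (h0 : W.analyticRank = 0)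
    (c : Chroma) : chromaticL c Lsharp Lflat ≠ 0 :=
  chromaticL_ne_zero_of_goodSS_of_analyticRank_eq_zero hp2 hf hX.1 hSP h0 c

end Classes

end Summit.BirchSwinnertonDyer.Rank1Residual.Supersingular

end
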